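import Literature.NumberTheory.DiophantineGeometry.SubexponentialAbcWithoutRadA
import HarnessLib

/-!
# stub-ideation k1 GEN 6 — `stub_splitCuspTriple` (crux stmt-ABC-26026 `CuspFieldPencil.GoldenCuspShadow`)

FAMILY 1 (recognise & import), TREE MATCH made checkable: the ARCHIMEDEAN HALF of the converged ℚ-line
(`cusp_transfer` / `orl_arch` of the landing kit) is the in-tree, PROVED Pasten–Sepúlveda-Manzo 2025 Thm 2.2
(«abc without rad(a)», `pastenSepulvedaManzo2025_thm_2_2_holds`) applied to the hidden triple
`w² + Q = u(u−11w)` with the DIRTY member `a = |u(u−11w)|` — `rad(a)` never appears.  Second-source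
helper statements only (the kit's own `orl_arch` is already proved); bodies `sorry` by design (ideation seat).
This module imports NO route cone (statement file `SubexponentialAbcWithoutRadA` only).
-/

set_option linter.dupNamespace false

namespace Summit.ABC.ABC.Cruxes.GoldenCuspShadow.SplitK1G6

open Literature.NumberTheory.DiophantineGeometry Dioph

/-- P1 (second source for the kit's `orl_arch`∘`cusp_transfer`): the archimedean cusp gap from PSM 2025 Thm 2.2.
All sign cases at once: if `|u(u−11w)|` is the largest member of the hidden triple the left side is `≤ 0`;
otherwise `c ∈ {w², |Q|}`, `c ≥ w²`, `a = |u(u−11w)|`, `rad(bc) = rad(w·Q)`, `c ≤ 13·H²`. -/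
theorem archGap_of_psm22 (h : PastenSepulvedaManzo2025_thm_2_2) :
    ∃ κ : ℝ, 0 < κ ∧ ∀ u w : ℤ, IsCoprime u w → u * w * (u ^ 2 - 11 * u * w - w ^ 2) ≠ 0 →
      2 * Real.log |(w : ℝ)| - Real.log |((u * (u - 11 * w) : ℤ) : ℝ)| ≤
        Real.exp (κ * psRate ((UniqueFactorizationMonoid.radical (w * (u ^ 2 - 11 * u * w - w ^ 2))).natAbs : ℕ)) *
          logStar (Real.log (13 * (max |(u : ℝ)| |(w : ℝ)|) ^ 2)) := by
  sorry

/-- P1a (radical bookkeeping used inside P1): `rad_ℕ(|w|² · |Q|) = |rad_ℤ(w · Q)|`. -/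
theorem radical_sq_mul_natAbs (w Q : ℤ) (hw : w ≠ 0) (hQ : Q ≠ 0) :
    UniqueFactorizationMonoid.radical (M := ℕ) (w.natAbs ^ 2 * Q.natAbs) =
      (UniqueFactorizationMonoid.radical (w * Q)).natAbs := by
  sorry

/-- P2 (transfer, pure real arithmetic; the kit's `cusp_transfer` with the PSM error term):
`log H ≤ log|u| + log 12 + E·L` (if `H = |u|` trivial; else `|u − 11w| ≤ 12 H`). -/
theorem transfer_of_archGap (E L : ℝ) (hE : 0 ≤ E) (hL : 0 ≤ L) (u w : ℤ) (hu : u ≠ 0) (hw : w ≠ 0)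
    (hgap : 2 * Real.log |(w : ℝ)| - Real.log |((u * (u - 11 * w) : ℤ) : ℝ)| ≤ E * L) :
    Real.log (max |(u : ℝ)| |(w : ℝ)|) ≤ Real.log |(u : ℝ)| + Real.log 12 + E * L := by
  sorry

/-- P3 (lopsided ε-rung, corollary of PSM 2025 Thm 1.3 = `pastenSepulvedaManzo2025_thm_1_3_holds`, or of P1+P2):
in the regime `|u| ≤ |w|^{1−δ}` the class satisfies abc with exponent `ε` in `rad(w·Q)` alone. -/
theorem lopsidedEps_of_psm13 (h : PastenSepulvedaManzo2025_thm_1_3) :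
    ∀ δ : ℝ, 0 < δ → δ < 1 → ∀ ε : ℝ, 0 < ε → ∃ κ : ℝ, ∀ u w : ℤ, IsCoprime u w →
      u * w * (u ^ 2 - 11 * u * w - w ^ 2) ≠ 0 → (|(u : ℝ)| ≤ |(w : ℝ)| ^ (1 - δ)) →
      Real.log |(w : ℝ)| ≤
        κ * (((UniqueFactorizationMonoid.radical (w * (u ^ 2 - 11 * u * w - w ^ 2))).natAbs : ℕ) : ℝ) ^ ε := by
  sorry

/-- Name certificates (tree match, FAMILY 1): the two PSM theorems are PROVED in the tree (no hypothesis). -/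
example : PastenSepulvedaManzo2025_thm_2_2 → PastenSepulvedaManzo2025_thm_1_3 :=
  PastenSepulvedaManzo2025_thm_1_3_of_thm_2_2

end Summit.ABC.ABC.Cruxes.GoldenCuspShadow.SplitK1G6
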